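import Mathlib.MeasureTheory.Constructions.Pi
import Mathlib.MeasureTheory.Integral.Pi
import Mathlib.MeasureTheory.Integral.Prod
import Summits.Ventures.LatticeQCDFlow.Scoring.SchwingerDysonPhi4
import Summits.Ventures.LatticeQCDFlow.Scoring.SchwingerDysonPhi4Lattice
import HarnessLib

/-!
# The lattice φ⁴ Schwinger–Dyson (virial) identity `⟨φ_x ∂S/∂φ_x⟩ = 1` for the Gibbs measure `e^{−S} dφ / Z` on `ℝ^Λ`

HONEST FRAMING: exact (Metropolis-corrected) sampling algorithms for lattice gauge theory;
figures of merit are autocorrelation/cost numbers at stated couplings and volumes; no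
continuum-physics claim.  (SCALAR calibration rung S0-A: not a gauge result.)

Venture `LatticeQCDFlow` (cell pub-lqcd), sub-topic `Scoring`; FANOUT row 2 (`s0-phi4`).  NEW WORK
of the cell (our own statement and proof), closing the item left open in the two companion files
`Scoring/SchwingerDysonPhi4.lean` (the one-variable tower) and `Scoring/SchwingerDysonPhi4Lattice.lean`
(the lattice bookkeeping): the integration over `ℝ^Λ`.

**Theorem (`gibbs_virial`).**  Let `Λ = Fin (n+1)` (any finite site set, enumerated), `J` ANY real
`Λ × Λ` matrix, `λ > 0`, `S(φ) = Σ_{x,y} φ_x J_{xy} φ_y + λ Σ_x φ_x⁴` (`latticePhi4Action`; the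
engine's nearest-neighbour action is the instance `J = −Δ_lat + m²`, `shiftPhi4Action_eq`).  Then
`e^{−S}` is Lebesgue integrable on `ℝ^Λ`, `Z = ∫ e^{−S} > 0`, and for every site `x`

  `⟨φ_x ∂S/∂φ_x⟩ := (1/Z) ∫ φ_x F_x(φ) e^{−S(φ)} dφ = 1`,   `F_x = ∂S/∂φ_x = latticePhi4Force`,

and summed over sites (`gibbs_virial_sum`, Euler) `2⟨S₂⟩ + 4⟨S₄⟩ = |Λ|`.  No symmetry, sign or
dimension hypothesis on `J`: in particular the tachyonic AKS 2019 sets (`m² = −4 < 0`) are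
covered — the quartic term alone confines the measure.

**Proof.**  (1) *Coercivity* `latticePhi4Action_ge`: `S(φ) ≥ Σ_w φ_w² − K`,
`K = (n+1)(M+1)²/(4λ)`, `M = Σ_{y,z}|J_{yz}|` (`quadForm_ge` + a completed square per site); hence
`e^{−S} ≤ e^{K} Π_w e^{−φ_w²}` (`gibbsWeight_le`).  (2) `|φ_x F_x − 1| ≤ (1 + Σ_y|J_{xy}+J_{yx}| +
4|λ|) Π_w (1 + φ_w⁴)` (`abs_virialObs_le`), so the integrand is dominated by
`C Π_w (1+φ_w⁴)e^{−φ_w²}`, integrable on the product space (`Integrable.fintype_prod`).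
(3) *Fubini along the `x`-th coordinate* (`MeasurableEquiv.piFinSuccAbove`, volume preserving):
on the line `t ↦ (φ with φ_x := t)` the action IS the quartic site potential
(`latticePhi4Action_update`) and the force IS its derivative (`latticePhi4Force_eq`), so the inner
integral is the `n = 1` instance of `integral_phi4Site_sd_pow` (coercivity
`phi4SitePotential_coercive`: `λ > 0`, ANY `a b c`) and vanishes for EVERY frozen exterior
(`integral_virialIntegrand_eq_zero`).  (4) Normalise.

Use (exactness battery / a reference-free scalar column): under exact sampling of `e^{−S}` the
residual `R_x = φ_x ∂S/∂φ_x − 1` has mean EXACTLY `0` at every `(m², λ > 0, L)` (volume average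
`2S₂/|Λ| + 4S₄/|Λ| − 1`).  NOT here: the power of such a column against the planted classes (a
canary, under the numerics gate); higher members of the tower (same proof, `n ≥ 2`).
-/

namespace Summit.Ventures.LatticeQCDFlow.Scoring

open Real MeasureTheory Set Filter Finset


section Gibbs

variable {n : ℕ}

/-- The (unnormalised) Gibbs density `e^{−S(φ)}` of the coupling-matrix φ⁴ action on `ℝ^{n+1}`
(sites `Fin (n+1)`, configurations `Fin (n+1) → ℝ`, reference measure Lebesgue `volume`). -/
noncomputable def gibbsWeight (J : Fin (n + 1) → Fin (n + 1) → ℝ) (lam : ℝ)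
    (φ : Fin (n + 1) → ℝ) : ℝ :=
  Real.exp (-latticePhi4Action J lam φ)

/-- The Gibbs density is positive. -/
theorem gibbsWeight_pos (J : Fin (n + 1) → Fin (n + 1) → ℝ) (lam : ℝ) (φ : Fin (n + 1) → ℝ) :
    0 < gibbsWeight J lam φ :=
  Real.exp_pos _

/-- **Quadratic-form bound**: `Σ_{y,z} φ_y J_{yz} φ_z ≥ −(Σ_{y,z} |J_{yz}|) Σ_w φ_w²`. -/
theorem quadForm_ge (J : Fin (n + 1) → Fin (n + 1) → ℝ) (φ : Fin (n + 1) → ℝ) :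
    -((∑ y, ∑ z, |J y z|) * ∑ w, φ w ^ 2) ≤ ∑ y, ∑ z, φ y * J y z * φ z := by
  have hQ : ∀ y, φ y ^ 2 ≤ ∑ w, φ w ^ 2 := fun y =>
    Finset.single_le_sum (f := fun w => φ w ^ 2) (fun w _ => sq_nonneg (φ w)) (Finset.mem_univ y)
  have hpt : ∀ y z, -(|J y z| * ∑ w, φ w ^ 2) ≤ φ y * J y z * φ z := by
    intro y z
    have h1 : |φ y| * |φ z| ≤ ∑ w, φ w ^ 2 := by
      nlinarith [hQ y, hQ z, abs_nonneg (φ y), abs_nonneg (φ z), sq_abs (φ y), sq_abs (φ z),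
        sq_nonneg (|φ y| - |φ z|)]
    have h3 : |φ y * J y z * φ z| ≤ |J y z| * ∑ w, φ w ^ 2 := by
      rw [abs_mul, abs_mul, mul_assoc, mul_left_comm]
      exact mul_le_mul_of_nonneg_left h1 (abs_nonneg _)
    linarith [neg_abs_le (φ y * J y z * φ z)]
  calc -((∑ y, ∑ z, |J y z|) * ∑ w, φ w ^ 2)
      = ∑ y, ∑ z, -(|J y z| * ∑ w, φ w ^ 2) := by
        rw [Finset.sum_mul, ← Finset.sum_neg_distrib]
        refine Finset.sum_congr rfl fun y _ => ?_
        rw [Finset.sum_mul, ← Finset.sum_neg_distrib]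
    _ ≤ ∑ y, ∑ z, φ y * J y z * φ z :=
        Finset.sum_le_sum fun y _ => Finset.sum_le_sum fun z _ => hpt y z

/-- **Coercivity of the lattice action** (`λ > 0`, any `J`): `Σ_w φ_w² − K ≤ S(φ)` with
`K = (n+1)(M+1)²/(4λ)`, `M = Σ_{y,z} |J_{yz}|`. -/
theorem latticePhi4Action_ge {lam : ℝ} (hlam : 0 < lam) (J : Fin (n + 1) → Fin (n + 1) → ℝ)
    (φ : Fin (n + 1) → ℝ) :
    (∑ w, φ w ^ 2) - (n + 1) * (((∑ y, ∑ z, |J y z|) + 1) ^ 2 / (4 * lam))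
      ≤ latticePhi4Action J lam φ := by
  have hA := quadForm_ge J φ
  set M := ∑ y, ∑ z, |J y z| with hM
  have hlam' : lam ≠ 0 := hlam.ne'
  have hsite : ∀ w, (M + 1) * φ w ^ 2 - (M + 1) ^ 2 / (4 * lam) ≤ lam * φ w ^ 4 := by
    intro w
    have h : 0 ≤ lam * (φ w ^ 2 - (M + 1) / (2 * lam)) ^ 2 := by positivity
    have e : lam * (φ w ^ 2 - (M + 1) / (2 * lam)) ^ 2
        = lam * φ w ^ 4 - (M + 1) * φ w ^ 2 + (M + 1) ^ 2 / (4 * lam) := by field_simp; ring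
    rw [e] at h
    linarith
  have hsum : (M + 1) * (∑ w, φ w ^ 2) - (n + 1) * ((M + 1) ^ 2 / (4 * lam))
      ≤ lam * ∑ w, φ w ^ 4 := by
    have h := Finset.sum_le_sum fun w (_ : w ∈ (Finset.univ : Finset (Fin (n + 1)))) => hsite w
    rw [Finset.sum_sub_distrib, Finset.sum_const, Finset.card_univ, Fintype.card_fin,
      nsmul_eq_mul, ← Finset.mul_sum, ← Finset.mul_sum] at h
    push_cast at h
    linarith
  unfold latticePhi4Action
  linarith

/-- **Gaussian domination of the Gibbs density**: `e^{−S(φ)} ≤ e^{K} Π_w e^{−φ_w²}`. -/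
theorem gibbsWeight_le {lam : ℝ} (hlam : 0 < lam) (J : Fin (n + 1) → Fin (n + 1) → ℝ)
    (φ : Fin (n + 1) → ℝ) :
    gibbsWeight J lam φ
      ≤ Real.exp ((n + 1) * (((∑ y, ∑ z, |J y z|) + 1) ^ 2 / (4 * lam)))
        * ∏ w, Real.exp (-(φ w ^ 2)) := by
  have h := latticePhi4Action_ge hlam J φ
  rw [gibbsWeight, ← Real.exp_sum, ← Real.exp_add]
  apply Real.exp_le_exp.mpr
  have e : ∑ w, -(φ w ^ 2) = -∑ w, φ w ^ 2 := by rw [Finset.sum_neg_distrib]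
  linarith

/-- **Product-polynomial bound on the virial observable**:
`|φ_x F_x(φ) − 1| ≤ (1 + Σ_y |J_{xy} + J_{yx}| + 4|λ|) Π_w (1 + φ_w⁴)`. -/
theorem abs_virialObs_le (J : Fin (n + 1) → Fin (n + 1) → ℝ) (lam : ℝ) (φ : Fin (n + 1) → ℝ)
    (x : Fin (n + 1)) :
    |φ x * latticePhi4Force J lam φ x - 1|
      ≤ (1 + (∑ y, |J x y + J y x|) + 4 * |lam|) * ∏ w, (1 + φ w ^ 4) := by
  set T := ∑ w, φ w ^ 4 with hT
  have hT0 : 0 ≤ T := Finset.sum_nonneg fun w _ => by positivity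
  have hTw : ∀ w, φ w ^ 4 ≤ T := fun w =>
    Finset.single_le_sum (f := fun w => φ w ^ 4) (fun w _ => by positivity) (Finset.mem_univ w)
  -- `1 + Σ a ≤ Π (1 + a)` for nonnegative `a` (folklore), by induction on the site set
  have hP : 1 + T ≤ ∏ w, (1 + φ w ^ 4) := by
    have key : ∀ s : Finset (Fin (n + 1)),
        1 + ∑ w ∈ s, φ w ^ 4 ≤ ∏ w ∈ s, (1 + φ w ^ 4) := by
      intro s
      induction s using Finset.induction_on with
      | empty => simp
      | insert j s hj ih =>
          rw [Finset.sum_insert hj, Finset.prod_insert hj]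
          have h4 : (0 : ℝ) ≤ φ j ^ 4 := by positivity
          have hs : (0 : ℝ) ≤ ∑ w ∈ s, φ w ^ 4 := Finset.sum_nonneg fun w _ => by positivity
          nlinarith
    exact key Finset.univ
  have hB0 : 0 ≤ ∑ y, |J x y + J y x| := Finset.sum_nonneg fun y _ => abs_nonneg _
  -- |φ_x φ_y| ≤ 1 + T
  have hxy : ∀ y, |φ x| * |φ y| ≤ 1 + T := fun y => by
    nlinarith [hTw x, hTw y, abs_nonneg (φ x), abs_nonneg (φ y), sq_abs (φ x), sq_abs (φ y),
      sq_nonneg (|φ x| - |φ y|), sq_nonneg (φ x ^ 2 - 1), sq_nonneg (φ y ^ 2 - 1)]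
  -- expand the observable
  have e : φ x * latticePhi4Force J lam φ x - 1
      = (∑ y, (J x y + J y x) * (φ x * φ y)) + 4 * lam * φ x ^ 4 - 1 := by
    unfold latticePhi4Force
    rw [mul_add, Finset.mul_sum, Finset.sum_congr rfl fun y _ => mul_left_comm (φ x) _ (φ y)]
    ring
  have h1 : |∑ y, (J x y + J y x) * (φ x * φ y)| ≤ (∑ y, |J x y + J y x|) * (1 + T) := by
    calc |∑ y, (J x y + J y x) * (φ x * φ y)|
        ≤ ∑ y, |(J x y + J y x) * (φ x * φ y)| := Finset.abs_sum_le_sum_abs _ _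
      _ ≤ ∑ y, |J x y + J y x| * (1 + T) := by
          refine Finset.sum_le_sum fun y _ => ?_
          rw [abs_mul, abs_mul]
          exact mul_le_mul_of_nonneg_left (hxy y) (abs_nonneg _)
      _ = (∑ y, |J x y + J y x|) * (1 + T) := by rw [Finset.sum_mul]
  have h2 : |4 * lam * φ x ^ 4| ≤ 4 * |lam| * (1 + T) := by
    rw [abs_mul, abs_mul, abs_of_nonneg (by positivity : (0 : ℝ) ≤ φ x ^ 4),
      abs_of_nonneg (by norm_num : (0 : ℝ) ≤ 4)]
    nlinarith [abs_nonneg lam, hTw x]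
  rw [e]
  calc |(∑ y, (J x y + J y x) * (φ x * φ y)) + 4 * lam * φ x ^ 4 - 1|
      ≤ |(∑ y, (J x y + J y x) * (φ x * φ y)) + 4 * lam * φ x ^ 4| + |(1 : ℝ)| := abs_sub _ _
    _ ≤ |∑ y, (J x y + J y x) * (φ x * φ y)| + |4 * lam * φ x ^ 4| + 1 := by
        rw [abs_one]; linarith [abs_add_le (∑ y, (J x y + J y x) * (φ x * φ y)) (4 * lam * φ x ^ 4)]
    _ ≤ (∑ y, |J x y + J y x|) * (1 + T) + 4 * |lam| * (1 + T) + 1 * (1 + T) := by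
        nlinarith [h1, h2, hT0]
    _ = (1 + (∑ y, |J x y + J y x|) + 4 * |lam|) * (1 + T) := by ring
    _ ≤ (1 + (∑ y, |J x y + J y x|) + 4 * |lam|) * ∏ w, (1 + φ w ^ 4) :=
        mul_le_mul_of_nonneg_left hP (by positivity)

/-- The product dominator `Π_w (1 + φ_w⁴) e^{−φ_w²}` is integrable on `ℝ^{n+1}`. -/
theorem integrable_prod_quartic_gaussian :
    Integrable (fun φ : Fin (n + 1) → ℝ => ∏ w, ((1 + φ w ^ 4) * Real.exp (-(φ w ^ 2)))) := by
  have h1 : Integrable (fun t : ℝ => (1 + t ^ 4) * Real.exp (-(t ^ 2))) := by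
    have a := integrable_pow_mul_gaussian one_pos 0
    have b := integrable_pow_mul_gaussian one_pos 4
    refine (a.add b).congr (Eventually.of_forall fun t => ?_)
    simp only [Pi.add_apply, pow_zero, one_mul, neg_mul]
    ring
  have h := Integrable.fintype_prod (ι := Fin (n + 1))
    (f := fun _ (t : ℝ) => (1 + t ^ 4) * Real.exp (-(t ^ 2))) (μ := fun _ => volume) (fun _ => h1)
  simpa [MeasureTheory.volume_pi] using h

/-- Continuity of the lattice action. -/
theorem continuous_latticePhi4Action (J : Fin (n + 1) → Fin (n + 1) → ℝ) (lam : ℝ) :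
    Continuous (latticePhi4Action J lam) := by
  unfold latticePhi4Action; fun_prop

/-- Continuity of the site force. -/
theorem continuous_latticePhi4Force (J : Fin (n + 1) → Fin (n + 1) → ℝ) (lam : ℝ)
    (x : Fin (n + 1)) : Continuous (fun φ => latticePhi4Force J lam φ x) := by
  unfold latticePhi4Force; fun_prop

/-- Continuity of the Gibbs density. -/
theorem continuous_gibbsWeight (J : Fin (n + 1) → Fin (n + 1) → ℝ) (lam : ℝ) :
    Continuous (gibbsWeight J lam) :=
  Real.continuous_exp.comp (continuous_latticePhi4Action J lam).neg

/-- **The Gibbs density is integrable** (`λ > 0`, any `J`). -/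
theorem integrable_gibbsWeight {lam : ℝ} (hlam : 0 < lam) (J : Fin (n + 1) → Fin (n + 1) → ℝ) :
    Integrable (gibbsWeight J lam) := by
  set K : ℝ := (n + 1) * (((∑ y, ∑ z, |J y z|) + 1) ^ 2 / (4 * lam)) with hK
  refine Integrable.mono' ((integrable_prod_quartic_gaussian (n := n)).const_mul (Real.exp K))
    (continuous_gibbsWeight J lam).aestronglyMeasurable (Eventually.of_forall fun φ => ?_)
  rw [Real.norm_eq_abs, abs_of_pos (gibbsWeight_pos J lam φ)]
  have hw := gibbsWeight_le hlam J φ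
  have hprod : ∏ w, Real.exp (-(φ w ^ 2)) ≤ ∏ w, ((1 + φ w ^ 4) * Real.exp (-(φ w ^ 2))) := by
    refine Finset.prod_le_prod (fun w _ => (Real.exp_pos _).le) fun w _ => ?_
    have : (0 : ℝ) ≤ φ w ^ 4 := by positivity
    nlinarith [Real.exp_pos (-(φ w ^ 2))]
  calc gibbsWeight J lam φ ≤ Real.exp K * ∏ w, Real.exp (-(φ w ^ 2)) := hw
    _ ≤ Real.exp K * ∏ w, ((1 + φ w ^ 4) * Real.exp (-(φ w ^ 2))) :=
        mul_le_mul_of_nonneg_left hprod (Real.exp_pos K).le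

/-- **The Schwinger–Dyson integrand `(φ_x F_x(φ) − 1) e^{−S(φ)}` is integrable** (`λ > 0`). -/
theorem integrable_virialIntegrand {lam : ℝ} (hlam : 0 < lam)
    (J : Fin (n + 1) → Fin (n + 1) → ℝ) (x : Fin (n + 1)) :
    Integrable (fun φ : Fin (n + 1) → ℝ =>
      (φ x * latticePhi4Force J lam φ x - 1) * gibbsWeight J lam φ) := by
  set K : ℝ := (n + 1) * (((∑ y, ∑ z, |J y z|) + 1) ^ 2 / (4 * lam)) with hK
  set B : ℝ := 1 + (∑ y, |J x y + J y x|) + 4 * |lam| with hB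
  have hB0 : 0 ≤ B := by
    have : 0 ≤ ∑ y, |J x y + J y x| := Finset.sum_nonneg fun y _ => abs_nonneg _
    positivity
  refine Integrable.mono' ((integrable_prod_quartic_gaussian (n := n)).const_mul (B * Real.exp K))
    ?_ (Eventually.of_forall fun φ => ?_)
  · exact (((continuous_apply x).mul (continuous_latticePhi4Force J lam x)).sub
      continuous_const).mul (continuous_gibbsWeight J lam) |>.aestronglyMeasurable
  rw [Real.norm_eq_abs, abs_mul, abs_of_pos (gibbsWeight_pos J lam φ)]
  have hobs := abs_virialObs_le J lam φ x
  have hw := gibbsWeight_le hlam J φ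
  have hP0 : 0 ≤ ∏ w, (1 + φ w ^ 4) := Finset.prod_nonneg fun w _ => by positivity
  calc |φ x * latticePhi4Force J lam φ x - 1| * gibbsWeight J lam φ
      ≤ (B * ∏ w, (1 + φ w ^ 4)) * (Real.exp K * ∏ w, Real.exp (-(φ w ^ 2))) :=
        mul_le_mul hobs hw (gibbsWeight_pos J lam φ).le (mul_nonneg hB0 hP0)
    _ = B * Real.exp K * ∏ w, ((1 + φ w ^ 4) * Real.exp (-(φ w ^ 2))) := by
        rw [Finset.prod_mul_distrib]
        ring

/-- Inserting the `x`-th coordinate is an update of the configuration with `φ_x = 0`. -/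
theorem insertNth_eq_update (x : Fin (n + 1)) (t : ℝ) (x' : Fin n → ℝ) :
    (Fin.insertNth x t x' : Fin (n + 1) → ℝ)
      = Function.update (Fin.insertNth x (0 : ℝ) x' : Fin (n + 1) → ℝ) x t := by
  ext j
  refine Fin.succAboveCases x ?_ (fun j => ?_) j
  · simp
  · simp

/-- **The lattice φ⁴ Schwinger–Dyson (virial) identity, unnormalised**: for `λ > 0`, any real
coupling matrix `J` and every site `x`, `∫_{ℝ^{n+1}} (φ_x ∂S/∂φ_x − 1) e^{−S(φ)} dφ = 0`.
Proof: Fubini along the `x`-th coordinate (`MeasurableEquiv.piFinSuccAbove`, volume preserving);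
on each coordinate line the action is the quartic site potential (`latticePhi4Action_update`), the
force is its derivative (`latticePhi4Force_eq`), and the one-variable tower
`integral_phi4Site_sd_pow` (`n = 1`, coercivity from `phi4SitePotential_coercive`) makes the inner
integral vanish for EVERY frozen exterior. -/
theorem integral_virialIntegrand_eq_zero {lam : ℝ} (hlam : 0 < lam)
    (J : Fin (n + 1) → Fin (n + 1) → ℝ) (x : Fin (n + 1)) :
    ∫ φ : Fin (n + 1) → ℝ, (φ x * latticePhi4Force J lam φ x - 1) * gibbsWeight J lam φ = 0 := by
  set G : (Fin (n + 1) → ℝ) → ℝ :=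
    fun φ => (φ x * latticePhi4Force J lam φ x - 1) * gibbsWeight J lam φ with hG
  have hGi : Integrable G := integrable_virialIntegrand hlam J x
  -- split off the `x`-th coordinate
  set e := MeasurableEquiv.piFinSuccAbove (fun _ : Fin (n + 1) => ℝ) x with he
  have hmp : MeasurePreserving e := volume_preserving_piFinSuccAbove (fun _ : Fin (n + 1) => ℝ) x
  have htrans : ∫ φ, G φ = ∫ x' : Fin n → ℝ, ∫ t : ℝ, G (Fin.insertNth x t x') := by
    rw [← (hmp.symm e).integral_comp e.symm.measurableEmbedding]
    have hG' : Integrable (fun z : ℝ × (Fin n → ℝ) => G (e.symm z))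
        ((volume : Measure ℝ).prod (volume : Measure (Fin n → ℝ))) :=
      (hmp.symm e).integrable_comp_emb e.symm.measurableEmbedding |>.2 hGi
    rw [show (volume : Measure (ℝ × (Fin n → ℝ))) = (volume : Measure ℝ).prod volume from rfl,
      integral_prod_symm _ hG']
    rfl
  change ∫ φ, G φ = 0
  rw [htrans]
  have hinner : ∀ x' : Fin n → ℝ, ∫ t : ℝ, G (Fin.insertNth x t x') = 0 := by
    intro x'
    set ψ : Fin (n + 1) → ℝ := Fin.insertNth x (0 : ℝ) x' with hψ
    have hψx : ψ x = 0 := by simp [hψ]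
    have hupd0 : Function.update ψ x 0 = ψ := by
      have h := Function.update_eq_self x ψ
      rwa [hψx] at h
    have h0 := integral_phi4Site_sd_pow (lam := lam) (a := J x x)
      (b := ∑ y, (J x y + J y x) * ψ y) (c := latticePhi4Action J lam ψ) one_pos
      (phi4SitePotential_coercive hlam _ _ _) 1
    simp only [Nat.cast_one, one_mul, Nat.sub_self, pow_zero, pow_one] at h0
    have hpt : ∀ t : ℝ, G (Fin.insertNth x t x')
        = -((1 - t * phi4SiteForce lam (J x x) (∑ y, (J x y + J y x) * ψ y) t)
            * phi4SiteWeight lam (J x x) (∑ y, (J x y + J y x) * ψ y)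
                (latticePhi4Action J lam ψ) t) := by
      intro t
      have hins : Fin.insertNth x t x' = Function.update ψ x t := insertNth_eq_update x t x'
      rw [hins, hG]
      simp only []
      rw [Function.update_self, gibbsWeight, latticePhi4Action_update J lam ψ x t, hupd0,
        ← latticePhi4Force_eq J lam (Function.update ψ x t) x, Function.update_self,
        Function.update_idem, hupd0]
      simp only [phi4SiteForce, phi4SiteWeight, phi4SitePotential]
      ring
    simp only [hpt, integral_neg, h0, neg_zero]
  simp only [hinner, integral_zero]

/-- The partition function `Z = ∫ e^{−S}`. -/
noncomputable def gibbsZ (J : Fin (n + 1) → Fin (n + 1) → ℝ) (lam : ℝ) : ℝ :=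
  ∫ φ : Fin (n + 1) → ℝ, gibbsWeight J lam φ

/-- `Z > 0` (`λ > 0`). -/
theorem gibbsZ_pos {lam : ℝ} (hlam : 0 < lam) (J : Fin (n + 1) → Fin (n + 1) → ℝ) :
    0 < gibbsZ J lam := by
  unfold gibbsZ
  have h := integrable_gibbsWeight hlam J
  unfold gibbsWeight at h ⊢
  exact integral_exp_pos h

/-- Gibbs expectation `⟨f⟩ = (1/Z) ∫ f e^{−S}`. -/
noncomputable def gibbsExpect (J : Fin (n + 1) → Fin (n + 1) → ℝ) (lam : ℝ)
    (f : (Fin (n + 1) → ℝ) → ℝ) : ℝ :=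
  (∫ φ : Fin (n + 1) → ℝ, f φ * gibbsWeight J lam φ) / gibbsZ J lam

/-- **The lattice φ⁴ virial identity `⟨φ_x ∂S/∂φ_x⟩ = 1`** for the Gibbs measure `e^{−S} dφ / Z`
of `S = Σ φJφ + λΣφ⁴` on `ℝ^{n+1}`: every `λ > 0`, every real `J`, every site `x`. -/
theorem gibbs_virial {lam : ℝ} (hlam : 0 < lam) (J : Fin (n + 1) → Fin (n + 1) → ℝ)
    (x : Fin (n + 1)) :
    gibbsExpect J lam (fun φ => φ x * latticePhi4Force J lam φ x) = 1 := by
  have hZ := gibbsZ_pos hlam J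
  have hw := integrable_gibbsWeight hlam J
  have hG := integrable_virialIntegrand hlam J x
  have h0 := integral_virialIntegrand_eq_zero hlam J x
  have hobs : Integrable (fun φ : Fin (n + 1) → ℝ =>
      φ x * latticePhi4Force J lam φ x * gibbsWeight J lam φ) := by
    refine (hG.add hw).congr (Eventually.of_forall fun φ => ?_)
    simp only [Pi.add_apply]
    ring
  have hsplit : ∫ φ : Fin (n + 1) → ℝ, (φ x * latticePhi4Force J lam φ x - 1) * gibbsWeight J lam φ
      = (∫ φ : Fin (n + 1) → ℝ, φ x * latticePhi4Force J lam φ x * gibbsWeight J lam φ)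
        - ∫ φ : Fin (n + 1) → ℝ, gibbsWeight J lam φ := by
    rw [← integral_sub hobs hw]
    congr 1
    ext φ
    ring
  unfold gibbsExpect gibbsZ
  rw [div_eq_one_iff_eq (by unfold gibbsZ at hZ; exact hZ.ne')]
  rw [hsplit] at h0
  linarith

/-- **Summed form**: `2⟨S₂⟩ + 4⟨S₄⟩ = n + 1` (`= |Λ|`), by the Euler identity
`Σ_x φ_x F_x = 2S₂ + 4S₄`; at `λ → 0` this is the free-field equipartition `⟨S⟩ = |Λ|/2`. -/
theorem gibbs_virial_sum {lam : ℝ} (hlam : 0 < lam) (J : Fin (n + 1) → Fin (n + 1) → ℝ) :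
    gibbsExpect J lam (fun φ => 2 * (∑ x, ∑ y, φ x * J x y * φ y) + 4 * (lam * ∑ x, φ x ^ 4))
      = (n + 1 : ℝ) := by
  have hZ := gibbsZ_pos hlam J
  have hw := integrable_gibbsWeight hlam J
  have hobs : ∀ x, Integrable (fun φ : Fin (n + 1) → ℝ =>
      φ x * latticePhi4Force J lam φ x * gibbsWeight J lam φ) := by
    intro x
    refine ((integrable_virialIntegrand hlam J x).add hw).congr (Eventually.of_forall fun φ => ?_)
    simp only [Pi.add_apply]
    ring
  have hx : ∀ x, ∫ φ : Fin (n + 1) → ℝ, φ x * latticePhi4Force J lam φ x * gibbsWeight J lam φ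
      = gibbsZ J lam := by
    intro x
    have h := gibbs_virial hlam J x
    unfold gibbsExpect at h
    rwa [div_eq_one_iff_eq hZ.ne'] at h
  unfold gibbsExpect
  rw [div_eq_iff hZ.ne']
  have e : ∀ φ : Fin (n + 1) → ℝ,
      (2 * (∑ x, ∑ y, φ x * J x y * φ y) + 4 * (lam * ∑ x, φ x ^ 4)) * gibbsWeight J lam φ
        = ∑ x, φ x * latticePhi4Force J lam φ x * gibbsWeight J lam φ := by
    intro φ
    rw [← sum_mul_latticePhi4Force, Finset.sum_mul]
  simp only [e]
  rw [integral_finsetSum _ (fun x _ => hobs x)]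
  simp only [hx, Finset.sum_const, Finset.card_univ, Fintype.card_fin, nsmul_eq_mul]
  push_cast
  ring

end Gibbs

end Summit.Ventures.LatticeQCDFlow.Scoring
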